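import Summits.ResolutionOfSingularities.ResolutionOfSingularities.Theorems.HilbertSamuelEliminationCampaignW42ConeVertexRidge
import Literature.RingTheory.HilbertSamuel.DirectrixLocal
import Literature.AlgebraicGeometry.Resolution.RidgePerfectField
import Mathlib.RingTheory.Localization.FractionRing
import Mathlib.RingTheory.Localization.Away.Basic
import Mathlib.Algebra.Polynomial.Roots
import Mathlib.FieldTheory.Perfect
import HarnessLib

/-!
# [OURS · L1 W4.2] The directrix does not move under the purely transcendental extension `K → K(X)`:
# `e(S/J)_{K(X)} = e(S/J)_K` for every field `K` (campaign s42, cell res-hironaka; informal crux `RidgeConfinement`,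
# stmt-ResolutionOfSingularities-17845; `--supports`; brick D2 of the directrix form of CJS Thm. 3.10 (4))

HONEST FRAMING. OURS (slot W4.2, prover res-L1-s42-pv-1, gen 6). [OURS · L1 W4.2] replaces the role of nothing printed in
H. Hironaka's manuscript; it is the descent step that lets Nagata's `𝒪'(X) = 𝒪'[X]_{𝔪'[X]}` (whose residue field is
`κ(x')(X)`) be used for the DIRECTRIX dimension over a field `K ⊇ κ(x')` that need not contain a transcendental: one passes to
`K(X)` and comes back. Statements:

* `finrank_directrixSpace_le_of_retracts` — SPECIALISATION: if every finitely generated `K`-subalgebra of a field `F ⊇ K`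
  admits a `K`-algebra homomorphism to `K`, then `dim_K 𝒯(J) ≤ dim_F 𝒯(J · F[Y])` for every ideal `J ⊆ K[Y]` (a directing
  space of `J · F[Y]` with a basis, the finitely many polynomial identities expressing «directs», their coefficients in a
  finitely generated subalgebra `R`, a retraction `R → K`: the specialised linear forms direct `J`); hence
  `directrixDim_map_eq_of_retracts` — `e(S/J)_F = e(S/J)_K` (the tree has `≥`, CJS Lemma 2.10 (2));
* `exists_algHom_adjoin_fractionRing_polynomial` — `K(X) = Frac K[X]` has this property when `K` is infinite (clear
  denominators, evaluate at a non-root);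
* **`directrixDim_map_fractionRingPolynomial_eq`** — `e(S/J)_{K(X)} = e(S/J)_K` for EVERY field `K` and every homogeneous
  `J` (finite `K` is perfect, where `e_K = dim F` is the ridge dimension, which is insensitive to the coefficient field and
  bounds every `e_L` from above — tree, gen 4/5).

NOT a statement of H. Hironaka's manuscript [Hironaka2017]. AI review is weaker than expert review. References (orientation
only): V. Cossart, U. Jannsen, S. Saito, LNM 2270 (2020), Lemma 2.10 (2), Def. 2.18, proof of Thm. 3.10 (4) p. 47;
J. Giraud, *Bull. Sci. Math.* 99 (1975) §1.5.
-/

noncomputable section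

-- single-conjunct summit: the doubled namespace component `ResolutionOfSingularities` is mandated
set_option linter.dupNamespace false

open MvPolynomial Module
open Literature.RingTheory.MvPolynomial Literature.RingTheory.HilbertSamuel
open Literature.AlgebraicGeometry.Resolution

namespace Summit.ResolutionOfSingularities.ResolutionOfSingularities.Theorems

namespace CampaignW42

universe u

/-! ## Small tools -/

/-- A polynomial whose image under an injective coefficient map is homogeneous is homogeneous. [folklore] -/
theorem isHomogeneous_of_map_injective {R S : Type*} [CommSemiring R] [CommSemiring S] {σ : Type*} {f : R →+* S}
    (hf : Function.Injective f) {p : MvPolynomial σ R} {d : ℕ} (h : (MvPolynomial.map f p).IsHomogeneous d) :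
    p.IsHomogeneous d := by
  intro m hm
  refine h ?_
  rw [coeff_map]
  exact fun h0 => hm (hf (by rw [h0, map_zero]))

/-- `map f (aeval v P) = aeval (map f ∘ v) (map f P)` for polynomial substitutions `v`. [folklore] -/
theorem map_aeval_eq_aeval_map {R S : Type*} [CommSemiring R] [CommSemiring S] {σ τ : Type*} (f : R →+* S)
    (v : τ → MvPolynomial σ R) (P : MvPolynomial τ R) :
    MvPolynomial.map f (aeval v P) = aeval (fun j => MvPolynomial.map f (v j)) (MvPolynomial.map f P) := by
  rw [MvPolynomial.aeval_def, MvPolynomial.algebraMap_eq, map_eval₂, MvPolynomial.aeval_def, MvPolynomial.algebraMap_eq]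
  rfl

/-! ## Specialisation: descent of directing spaces along a retraction -/

section Retracts

variable {K : Type u} {F : Type u} [Field K] [Field F] [Algebra K F] {n : ℕ}

/-- **Specialisation of a directing space.** If every finitely generated `K`-subalgebra of `F` has a `K`-point
(`R →ₐ[K] K`), then `dim_K 𝒯(J) ≤ dim_F 𝒯(J · F[Y])` for every ideal `J ⊆ K[Y_1, …, Y_n]`: the directrix space does not
shrink under `K → F`. [cite: CossartJannsenSaito2020, Lemma 2.10 (2), Def. 2.8] -/
theorem finrank_directrixSpace_le_of_retracts
    (hret : ∀ s : Finset F, Nonempty (Algebra.adjoin K (s : Set F) →ₐ[K] K))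
    (J : Ideal (MvPolynomial (Fin n) K)) :
    finrank K (directrixSpace J) ≤ finrank F (directrixSpace (J.map (MvPolynomial.map (algebraMap K F)))) := by
  classical
  set ι : K →+* F := algebraMap K F with hιdef
  set JF := J.map (MvPolynomial.map ι) with hJF
  -- generators of `J`
  obtain ⟨m, f, hfJ⟩ := Submodule.fg_iff_exists_fin_generating_family.mp
    ((inferInstance : IsNoetherianRing (MvPolynomial (Fin n) K)) |> fun _ => IsNoetherian.noetherian J)
  have hJFspan : JF = Ideal.span (Set.range fun i => MvPolynomial.map ι (f i)) := by
    rw [hJF, ← hfJ, Ideal.map_span, ← Set.range_comp]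
    rfl
  -- a basis `ℓ` of the directrix space of `J_F`
  set TF := directrixSpace JF with hTFdef
  haveI : FiniteDimensional F TF := Submodule.finiteDimensional_of_le (directrixSpace_le_one JF)
  set t := finrank F TF with htdef
  let b := Module.finBasis F TF
  let ℓ : Fin t → MvPolynomial (Fin n) F := fun k => (b k : MvPolynomial (Fin n) F)
  have hℓhom : ∀ k, (ℓ k).IsHomogeneous 1 := fun k =>
    (mem_homogeneousSubmodule _ _).mp (directrixSpace_le_one JF (b k).2)
  have hTFspan : (TF : Set (MvPolynomial (Fin n) F)) = Submodule.span F (Set.range ℓ) := by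
    have h1 : Submodule.map TF.subtype (Submodule.span F (Set.range b)) = Submodule.span F (Set.range ℓ) := by
      rw [Submodule.map_span, ← Set.range_comp]
      rfl
    rw [b.span_eq, Submodule.map_top, Submodule.range_subtype] at h1
    rw [h1]
  have hadj : Algebra.adjoin F (TF : Set (MvPolynomial (Fin n) F)) = (aeval (R := F) ℓ).range := by
    rw [hTFspan, Algebra.adjoin_span, Algebra.adjoin_range_eq_range_aeval]
  have hdir := directs_directrixSpace JF
  -- (1) every generator is a combination of elements of `J_F ∩ F[ℓ]`
  have hgen : ∀ i : Fin m, ∃ (N : ℕ) (c : Fin N → MvPolynomial (Fin n) F) (g : Fin N → MvPolynomial (Fin n) F),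
      (∀ j, g j ∈ JF ∧ g j ∈ (aeval (R := F) ℓ).range) ∧ ∑ j, c j * g j = MvPolynomial.map ι (f i) := by
    intro i
    have hfi : MvPolynomial.map ι (f i) ∈ JF := by
      rw [hJFspan]; exact Ideal.subset_span ⟨i, rfl⟩
    have h := hdir.2 hfi
    rw [← hTFdef, hadj] at h
    obtain ⟨N, c, g, hsum⟩ := Submodule.mem_span_set'.mp h
    refine ⟨N, c, fun j => (g j : MvPolynomial (Fin n) F), fun j => (g j).2, ?_⟩
    simpa only [smul_eq_mul] using hsum
  choose N c g hg hsum using hgen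
  -- (2) each `g i j` is a polynomial in `ℓ` and a combination of the generators
  have hP : ∀ i (j : Fin (N i)), ∃ P : MvPolynomial (Fin t) F, aeval ℓ P = g i j := fun i j => (hg i j).2
  choose P hP using hP
  have hq : ∀ i (j : Fin (N i)), ∃ q : Fin m → MvPolynomial (Fin n) F, ∑ l, q l * MvPolynomial.map ι (f l) = g i j :=
    fun i j => Ideal.mem_span_range_iff_exists_fun.mp (by rw [← hJFspan]; exact (hg i j).1)
  choose q hq using hq
  -- (3) the finitely many coefficients, the subalgebra `R` they generate, and a retraction `φ : R → K`
  let s : Finset F := (Finset.univ.biUnion fun k : Fin t => (ℓ k).coeffs) ∪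
    Finset.univ.biUnion fun i : Fin m => Finset.univ.biUnion fun j : Fin (N i) =>
      (c i j).coeffs ∪ (P i j).coeffs ∪ Finset.univ.biUnion fun l : Fin m => (q i j l).coeffs
  set R : Subalgebra K F := Algebra.adjoin K (s : Set F) with hRdef
  obtain ⟨φ⟩ := hret s
  have hsR : (s : Set F) ⊆ R := Algebra.subset_adjoin
  have hrange : Set.range (algebraMap R F) = (R : Set F) := by
    ext x; constructor
    · rintro ⟨y, rfl⟩; exact y.2
    · intro hx; exact ⟨⟨x, hx⟩, rfl⟩
  have hRinj : Function.Injective (algebraMap R F) := Subtype.val_injective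
  -- every datum has coefficients in `R`, hence lifts to `R`
  have hlift : ∀ {τ : Type} (p : MvPolynomial τ F), (p.coeffs : Set F) ⊆ (s : Set F) →
      ∃ p' : MvPolynomial τ R, MvPolynomial.map (algebraMap R F) p' = p := by
    intro τ p hp
    have h : p ∈ Set.range (MvPolynomial.map (algebraMap R F)) := by
      rw [mem_range_map_iff_coeffs_subset, hrange]
      exact hp.trans hsR
    exact h
  have hsℓ : ∀ k, ((ℓ k).coeffs : Set F) ⊆ (s : Set F) := fun k x hx => by
    refine Finset.mem_coe.mpr (Finset.mem_union_left _ (Finset.mem_biUnion.mpr ⟨k, Finset.mem_univ _, hx⟩))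
  have hsc : ∀ i j, ((c i j).coeffs : Set F) ⊆ (s : Set F) := fun i j x hx => by
    refine Finset.mem_coe.mpr (Finset.mem_union_right _ (Finset.mem_biUnion.mpr ⟨i, Finset.mem_univ _,
      Finset.mem_biUnion.mpr ⟨j, Finset.mem_univ _, ?_⟩⟩))
    exact Finset.mem_union_left _ (Finset.mem_union_left _ hx)
  have hsP : ∀ i j, ((P i j).coeffs : Set F) ⊆ (s : Set F) := fun i j x hx => by
    refine Finset.mem_coe.mpr (Finset.mem_union_right _ (Finset.mem_biUnion.mpr ⟨i, Finset.mem_univ _,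
      Finset.mem_biUnion.mpr ⟨j, Finset.mem_univ _, ?_⟩⟩))
    exact Finset.mem_union_left _ (Finset.mem_union_right _ hx)
  have hsq : ∀ i j l, ((q i j l).coeffs : Set F) ⊆ (s : Set F) := fun i j l x hx => by
    refine Finset.mem_coe.mpr (Finset.mem_union_right _ (Finset.mem_biUnion.mpr ⟨i, Finset.mem_univ _,
      Finset.mem_biUnion.mpr ⟨j, Finset.mem_univ _, ?_⟩⟩))
    exact Finset.mem_union_right _ (Finset.mem_biUnion.mpr ⟨l, Finset.mem_univ _, hx⟩)
  have eℓ : ∀ k, ∃ p' : MvPolynomial (Fin n) R, MvPolynomial.map (algebraMap R F) p' = ℓ k := fun k => hlift _ (hsℓ k)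
  have ec : ∀ i j, ∃ p' : MvPolynomial (Fin n) R, MvPolynomial.map (algebraMap R F) p' = c i j :=
    fun i j => hlift _ (hsc i j)
  have eP : ∀ i j, ∃ p' : MvPolynomial (Fin t) R, MvPolynomial.map (algebraMap R F) p' = P i j :=
    fun i j => hlift _ (hsP i j)
  have eq' : ∀ i j l, ∃ p' : MvPolynomial (Fin n) R, MvPolynomial.map (algebraMap R F) p' = q i j l :=
    fun i j l => hlift _ (hsq i j l)
  choose ℓ' hℓ' using eℓ
  choose c' hc' using ec
  choose P' hP' using eP
  choose q' hq' using eq'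
  -- the generators over `R` and the elements `g` over `R`
  let f' : Fin m → MvPolynomial (Fin n) R := fun l => MvPolynomial.map (algebraMap K R) (f l)
  have hf' : ∀ l, MvPolynomial.map (algebraMap R F) (f' l) = MvPolynomial.map ι (f l) := fun l => by
    simp only [f', MvPolynomial.map_map, hιdef]
    rfl
  let g' : (i : Fin m) → Fin (N i) → MvPolynomial (Fin n) R := fun i j => aeval ℓ' (P' i j)
  have hg' : ∀ i j, MvPolynomial.map (algebraMap R F) (g' i j) = g i j := fun i j => by
    rw [← hP i j]
    simp only [g', map_aeval_eq_aeval_map, hℓ', hP']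
  -- the identities hold over `R` (the coefficient map `R → F` is injective)
  have hinj := MvPolynomial.map_injective (algebraMap R F) hRinj (σ := Fin n)
  have hsum' : ∀ i, ∑ j, c' i j * g' i j = f' i := fun i => hinj (by
    simp only [map_sum, map_mul, hc', hg', hf']
    exact hsum i)
  have hqsum' : ∀ i j, ∑ l, q' i j l * f' l = g' i j := fun i j => hinj (by
    simp only [map_sum, map_mul, hq', hf', hg']
    exact hq i j)
  -- (4) specialise along `φ`
  let ψ : MvPolynomial (Fin n) R →+* MvPolynomial (Fin n) K := MvPolynomial.map (φ : R →+* K)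
  have hψf : ∀ l, ψ (f' l) = f l := fun l => by
    simp only [ψ, f', MvPolynomial.map_map]
    rw [AlgHom.comp_algebraMap, Algebra.algebraMap_self, MvPolynomial.map_id]
  let v : Fin t → MvPolynomial (Fin n) K := fun k => ψ (ℓ' k)
  have hvhom : ∀ k, (v k).IsHomogeneous 1 := fun k => by
    have h1 : (ℓ' k).IsHomogeneous 1 := isHomogeneous_of_map_injective hRinj (by rw [hℓ']; exact hℓhom k)
    exact h1.map _
  let T : Submodule K (MvPolynomial (Fin n) K) := Submodule.span K (Set.range v)
  have hT1 : T ≤ homogeneousSubmodule (Fin n) K 1 :=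
    Submodule.span_le.mpr (by rintro _ ⟨k, rfl⟩; exact (mem_homogeneousSubmodule _ _).mpr (hvhom k))
  have hψg_adj : ∀ i j, ψ (g' i j) ∈ Algebra.adjoin K (T : Set (MvPolynomial (Fin n) K)) := fun i j => by
    rw [Algebra.adjoin_span, Algebra.adjoin_range_eq_range_aeval]
    refine ⟨MvPolynomial.map (φ : R →+* K) (P' i j), ?_⟩
    change aeval v (MvPolynomial.map (φ : R →+* K) (P' i j)) =
      MvPolynomial.map (φ : R →+* K) (aeval ℓ' (P' i j))
    rw [map_aeval_eq_aeval_map]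
  have hψg_J : ∀ i j, ψ (g' i j) ∈ J := fun i j => by
    rw [← hqsum' i j, map_sum]
    refine Ideal.sum_mem _ fun l _ => ?_
    rw [map_mul, hψf]
    refine Ideal.mul_mem_left _ _ ?_
    rw [← hfJ]
    exact Ideal.subset_span ⟨l, rfl⟩
  -- (5) `T` directs `J`
  have hTdir : Directs J T := by
    refine ⟨hT1, ?_⟩
    calc J = Ideal.span (Set.range f) := hfJ.symm
      _ ≤ _ := Ideal.span_le.mpr ?_
    rintro _ ⟨i, rfl⟩
    rw [SetLike.mem_coe, ← hψf i, ← hsum' i, map_sum]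
    refine Ideal.sum_mem _ fun j _ => ?_
    rw [map_mul]
    exact Ideal.mul_mem_left _ _ (Ideal.subset_span ⟨hψg_J i j, hψg_adj i j⟩)
  haveI : FiniteDimensional K T := Submodule.finiteDimensional_of_le hT1
  calc finrank K (directrixSpace J) ≤ finrank K T := Submodule.finrank_mono (directrixSpace_le hTdir)
    _ ≤ Fintype.card (Fin t) := finrank_range_le_card v
    _ = t := Fintype.card_fin t

/-- **`e(S/J)_F = e(S/J)_K` along an extension with `K`-points on every finitely generated subalgebra** (the tree's
CJS Lemma 2.10 (2) gives `≤`; specialisation gives `≥`). [cite: CossartJannsenSaito2020, Lemma 2.10 (2)] -/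
theorem directrixDim_map_eq_of_retracts (hret : ∀ s : Finset F, Nonempty (Algebra.adjoin K (s : Set F) →ₐ[K] K))
    (J : Ideal (MvPolynomial (Fin n) K)) :
    directrixDim (J.map (MvPolynomial.map (algebraMap K F))) = directrixDim J := by
  refine le_antisymm ?_ (directrixDim_le_directrixDim_map (algebraMap K F) J)
  unfold directrixDim
  have h1 := finrank_directrixSpace_le_of_retracts hret J
  have h2 := finrank_directrixSpace_le (J.map (MvPolynomial.map (algebraMap K F)))
  omega

end Retracts

/-! ## `K(X)` has `K`-points on finitely generated subalgebras (`K` infinite) -/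

section RationalFunctions

variable (K : Type u) [Field K]

/-- **Clearing denominators and evaluating at a non-root**: for `K` infinite, every finitely generated `K`-subalgebra of
`K(X) = Frac K[X]` admits a `K`-algebra homomorphism to `K`. [folklore] -/
theorem exists_algHom_adjoin_fractionRing_polynomial [Infinite K] (s : Finset (FractionRing (Polynomial K))) :
    Nonempty (Algebra.adjoin K (s : Set (FractionRing (Polynomial K))) →ₐ[K] K) := by
  classical
  -- numerators and denominators: `x · den x = num x`
  let pr : FractionRing (Polynomial K) → Polynomial K × nonZeroDivisors (Polynomial K) :=
    IsLocalization.sec (nonZeroDivisors (Polynomial K))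
  have hpr : ∀ x : FractionRing (Polynomial K), x * algebraMap (Polynomial K) (FractionRing (Polynomial K)) ((pr x).2 : Polynomial K) =
      algebraMap (Polynomial K) (FractionRing (Polynomial K)) (pr x).1 := fun x => IsLocalization.sec_spec _ x
  -- a common denominator `D` and a point `a` with `D(a) ≠ 0`
  let D : Polynomial K := ∏ x ∈ s, ((pr x).2 : Polynomial K)
  have hD0 : D ≠ 0 := Finset.prod_ne_zero_iff.mpr fun x _ => nonZeroDivisors.ne_zero (pr x).2.2
  obtain ⟨a, ha⟩ : ∃ a : K, D.eval a ≠ 0 := by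
    by_contra h
    push Not at h
    exact hD0 (Polynomial.zero_of_eval_zero D h)
  -- `B = K[X][1/D]`, its map `j : B → K(X)` and the evaluation `ev : B → K`
  have hDunitF : IsUnit (algebraMap (Polynomial K) (FractionRing (Polynomial K)) D) :=
    isUnit_iff_ne_zero.mpr fun h => hD0 (IsFractionRing.to_map_eq_zero_iff.mp h)
  have hDunitK : IsUnit (Polynomial.evalRingHom a D) := isUnit_iff_ne_zero.mpr ha
  let jr : Localization.Away D →+* FractionRing (Polynomial K) := IsLocalization.Away.lift D hDunitF
  let evr : Localization.Away D →+* K := IsLocalization.Away.lift D hDunitK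
  have hjr : ∀ p : Polynomial K, jr (algebraMap (Polynomial K) (Localization.Away D) p) =
      algebraMap (Polynomial K) (FractionRing (Polynomial K)) p := fun p => IsLocalization.Away.lift_eq D hDunitF p
  have hevr : ∀ p : Polynomial K, evr (algebraMap (Polynomial K) (Localization.Away D) p) = p.eval a := fun p =>
    IsLocalization.Away.lift_eq D hDunitK p
  let j : Localization.Away D →ₐ[K] FractionRing (Polynomial K) :=
    { toRingHom := jr
      commutes' := fun r => by
        change jr (algebraMap K (Localization.Away D) r) = _
        rw [IsScalarTower.algebraMap_apply K (Polynomial K) (Localization.Away D), hjr,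
          ← IsScalarTower.algebraMap_apply] }
  let ev : Localization.Away D →ₐ[K] K :=
    { toRingHom := evr
      commutes' := fun r => by
        change evr (algebraMap K (Localization.Away D) r) = _
        rw [IsScalarTower.algebraMap_apply K (Polynomial K) (Localization.Away D), hevr, Polynomial.algebraMap_apply,
          Polynomial.eval_C, Algebra.algebraMap_self, RingHom.id_apply] }
  -- `j` is injective
  have hinjB : Function.Injective (algebraMap (Polynomial K) (Localization.Away D)) :=
    IsLocalization.injective (Localization.Away D) (powers_le_nonZeroDivisors_of_noZeroDivisors hD0)
  have hjinj : Function.Injective j := by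
    change Function.Injective (IsLocalization.Away.lift D hDunitF)
    refine (IsLocalization.lift_injective_iff _).mpr fun x y => ?_
    constructor
    · intro h; rw [hinjB h]
    · intro h; rw [IsFractionRing.injective (Polynomial K) (FractionRing (Polynomial K)) h]
  -- `s ⊆ j(B)`
  have hsub : Algebra.adjoin K (s : Set (FractionRing (Polynomial K))) ≤ j.range := by
    refine Algebra.adjoin_le fun x hx => ?_
    obtain ⟨E, hE⟩ : ((pr x).2 : Polynomial K) ∣ D := Finset.dvd_prod_of_mem _ (Finset.mem_coe.mp hx)
    refine ⟨algebraMap (Polynomial K) (Localization.Away D) ((pr x).1 * E) * IsLocalization.Away.invSelf D, ?_⟩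
    change jr _ = x
    have hinv : jr (IsLocalization.Away.invSelf D) * algebraMap (Polynomial K) (FractionRing (Polynomial K)) D = 1 := by
      rw [← hjr D, ← map_mul, mul_comm, IsLocalization.Away.mul_invSelf, map_one]
    have hx' : x * algebraMap (Polynomial K) (FractionRing (Polynomial K)) D =
        algebraMap (Polynomial K) (FractionRing (Polynomial K)) ((pr x).1 * E) := by
      rw [hE, map_mul, map_mul, ← mul_assoc, hpr x]
    rw [map_mul, hjr]
    calc algebraMap (Polynomial K) (FractionRing (Polynomial K)) ((pr x).1 * E) * jr (IsLocalization.Away.invSelf D)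
        = x * (algebraMap (Polynomial K) (FractionRing (Polynomial K)) D * jr (IsLocalization.Away.invSelf D)) := by
          rw [← hx', mul_assoc]
      _ = x := by rw [mul_comm (algebraMap _ _ D), hinv, mul_one]
  exact ⟨ev.comp (((AlgEquiv.ofInjective j hjinj).symm : j.range →ₐ[K] Localization.Away D).comp
    (Subalgebra.inclusion hsub))⟩

/-- **`e(S/J)_{K(X)} = e(S/J)_K` for every field `K` and every homogeneous ideal `J ⊆ K[Y_1, …, Y_n]`** (`K(X) = Frac K[X]`):
for infinite `K` by specialisation; for finite `K` because `K` is then perfect, so `e(S/J)_K = dim F(J)` (Giraud's ridge,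
tree) which bounds `e(S/J)_L` for every `L` and does not depend on the coefficient field.
[cite: CossartJannsenSaito2020, Lemma 2.10 (2), Def. 2.8] [cite: Giraud1975, §1.5] -/
theorem directrixDim_map_fractionRingPolynomial_eq {n : ℕ} (J : Ideal (MvPolynomial (Fin n) K)) (hJ : IsHomogeneousIdeal J) :
    directrixDim (J.map (MvPolynomial.map (algebraMap K (FractionRing (Polynomial K))))) = directrixDim J := by
  cases finite_or_infinite K with
  | inr hK => exact directrixDim_map_eq_of_retracts (exists_algHom_adjoin_fractionRing_polynomial K) J
  | inl hK =>
    haveI : PerfectField K := PerfectField.ofFinite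
    refine le_antisymm ?_ (directrixDim_le_directrixDim_map _ J)
    have h1 := directrixDim_le_ridgeDim (J.map (MvPolynomial.map (algebraMap K (FractionRing (Polynomial K)))))
    have h2 : ridgeDim (J.map (MvPolynomial.map (algebraMap K (FractionRing (Polynomial K))))) = ridgeDim J :=
      ridgeDim_map_eq hJ _
    have h3 : ridgeDim J = directrixDim J := by
      have h := (radical_ridgeIdeal_coneIdeal_eq_and_ridgeDim_eq J hJ K).2
      have hid : (MvPolynomial.map (algebraMap K K) : MvPolynomial (Fin n) K →+* MvPolynomial (Fin n) K) = RingHom.id _ :=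
        RingHom.ext fun p => by rw [Algebra.algebraMap_self, MvPolynomial.map_id]; rfl
      rwa [coneIdeal, hid, Ideal.map_id] at h
    omega

end RationalFunctions

end CampaignW42

end Summit.ResolutionOfSingularities.ResolutionOfSingularities.Theorems

end
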